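import Summits.BirchSwinnertonDyer.BirchSwinnertonDyer.Theorems.EisensteinDepletionAtTwoStarPlusOddClass
import Summits.BirchSwinnertonDyer.BirchSwinnertonDyer.Theorems.EisensteinDepletionAtTwoStarHalfPeriodRoots
import Literature.NumberTheory.EllipticCurves.RealLatticeCovolumeProofs
import Literature.NumberTheory.EllipticCurves.PAdicLFunctionMinusIntegralityProofs
import HarnessLib

/-!
# Lemmas for the loop parity of a NON-odd rational `2`-torsion point (line `parities` on crux `StarGO2`,
# item stmt-BirchSwinnertonDyer-24444, route `EisensteinDepletionAtTwo`): parity lattices of a rectangular real lattice and the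
# two pure parities (real period ↔ minus symbol, imaginary period ↔ plus symbol)

Twin, on the minus side, of `star_plusOddClass` (eng-2 GEN 11): for the optimal model `(W₀, L₀ = q·Λ_f)` of the class of a newform
`f` of `W` and a rational `2`-torsion abscissa `x₀` of `W₀` which is NOT the least real root, the lattice is rectangular
(`Λ₀ = ℤΩ₀ ⊕ ℤ·iΩ₀'`, three real roots) and

* if `x₀` is the LARGEST root then `x₀ + b₂/12 = ℘(Ω₀/2)` and, with `λ = Ω₀` (the real period), the loop `{0 → b/d}` pairs evenly with
  `λ/2` iff the minus symbol `2([b/d]⁻ − [0]⁻) = n⁻` is even (`star_loopParity_real`: `im Λ_f = ℤΩ⁻/2`, real lattice points are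
  the multiples of `Ω₀`);
* otherwise `x₀` is the MIDDLE root, `x₀ + b₂/12 = ℘((Ω₀ + iΩ₀')/2)` (three distinct real roots ⇒ `disc > 0` ⇒ rectangular,
  `IsReal.half_sum_notMem_of_discr_pos`; the third half-period value is the remaining root, `cubic_eq_prod_of_roots`), and with
  `λ = Ω₀ + iΩ₀'` the loop parity is that of `n⁺ + n⁻` (`parityLattice_sum_iff`: in `Λ₀/2Λ₀ ≅ 𝔽₂²` the class of `Ω₀ + iΩ₀'` is
  the third nonzero class, so `z ∈ ℤλ + 2Λ₀ ⟺ (z ∈ ℤΩ₀ + 2Λ₀ ⟺ z ∈ ℤiΩ₀' + 2Λ₀)`, and the two sides are the minus and plus parities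
  `star_loopParity_real`, `star_loopParity_imag`).

The assembled stub body `star_loopParityNonOdd` is in the sibling file `…StarGO2LoopParityNonOdd.lean`; this file holds §1–§3.

HONEST FRAMING: real-lattice bookkeeping for the skeleton of an OPEN crux; `StarGO2` is not proved by it; nothing reads an analytic
rank; BSD is not proved by any of this.

References: D. F. Lawden, *Elliptic Functions and Applications* (1989), §§6.11, 6.15–6.16 [Lawden1989]; J. E. Cremona, *Algorithms for
Modular Elliptic Curves* (1997), §2.8, §2.10 [CremonaAlgorithms1997]; B. Mazur, J. Tate, J. Teitelbaum, Invent. Math. 84 (1986), §I.8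
[MazurTateTeitelbaum1986Invent].
-/

set_option linter.dupNamespace false
set_option autoImplicit false

noncomputable section

open scoped MatrixGroups ModularForm ComplexConjugate PeriodPair

open Complex CongruenceSubgroup Literature.NumberTheory.EllipticCurves Literature.NumberTheory.EllipticCurves.ModularForms
  Literature.NumberTheory.EllipticCurves.Greenberg1999

namespace Summit.BirchSwinnertonDyer.BirchSwinnertonDyer.Theorems.DepletionAtTwo

/-! ### §1. Parity lattices in a real lattice: coordinates -/

section ParityLattices

variable {L : PeriodPair}

/-- Uniqueness of coordinates on a period pair (`ω₁, ω₂` are `ℝ`-independent). [folklore] -/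
theorem periodPair_coords_unique (L : PeriodPair) {a b a' b' : ℤ}
    (h : (a : ℂ) * L.ω₁ + (b : ℂ) * L.ω₂ = (a' : ℂ) * L.ω₁ + (b' : ℂ) * L.ω₂) : a = a' ∧ b = b' := by
  have key := LinearIndependent.pair_iff.mp L.indep ((a : ℝ) - a') ((b : ℝ) - b') (by
    simp only [Complex.real_smul]
    push_cast
    linear_combination h)
  obtain ⟨h1, h2⟩ := key
  constructor
  · exact_mod_cast (sub_eq_zero.mp h1)
  · exact_mod_cast (sub_eq_zero.mp h2)

/-- **The three index-`2` parity lattices of a rectangular real lattice.**  If `Λ` is real and rectangular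
(`(Ω₀ + iΩ₀')/2 ∉ Λ`), then for `z ∈ Λ`:
`z ∈ ℤ(Ω₀ + iΩ₀') + 2Λ ⟺ (z ∈ ℤΩ₀ + 2Λ ⟺ z ∈ ℤ·iΩ₀' + 2Λ)` (`Λ = ℤΩ₀ ⊕ ℤ·iΩ₀'`, `IsReal.exists_eq_lattice`; in coordinates
`z = mΩ₀ + n·iΩ₀'` the three conditions read `m ≡ n`, `n ≡ 0`, `m ≡ 0 (mod 2)`). [cite: CremonaAlgorithms1997, §2.10 (pp. 29–30)]
[cite: Lawden1989, §6.15] -/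
theorem parityLattice_sum_iff (h : L.IsReal)
    (hrect : ((L.minRealPeriod : ℂ) + I * (L.mulLeft I I_ne_zero).minRealPeriod) / 2 ∉ L.lattice) {z : ℂ}
    (hz : z ∈ L.lattice) :
    (∃ k : ℤ, ∃ w ∈ L.lattice, z = (k : ℂ) * ((L.minRealPeriod : ℂ) + I * (L.mulLeft I I_ne_zero).minRealPeriod) + 2 * w) ↔
      ((∃ k : ℤ, ∃ w ∈ L.lattice, z = (k : ℂ) * (L.minRealPeriod : ℂ) + 2 * w) ↔
        (∃ k : ℤ, ∃ w ∈ L.lattice, z = (k : ℂ) * (I * (L.mulLeft I I_ne_zero).minRealPeriod) + 2 * w)) := by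
  set Ω : ℂ := (L.minRealPeriod : ℂ) with hΩ
  set Ω' : ℂ := I * (L.mulLeft I I_ne_zero).minRealPeriod with hΩ'
  -- the rectangular basis
  obtain ⟨L₁, hL₁, hω₁, hω₂⟩ := h.exists_eq_lattice
  rw [if_neg hrect] at hω₂
  have hmem : ∀ x : ℂ, x ∈ L.lattice ↔ ∃ m n : ℤ, (m : ℂ) * Ω + (n : ℂ) * Ω' = x := by
    intro x
    rw [← hL₁, PeriodPair.mem_lattice, hω₁, hω₂]
  obtain ⟨m, n, hmn⟩ := (hmem z).mp hz
  have hΩmem : Ω ∈ L.lattice := h.minRealPeriod_mem_lattice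
  have hΩ'mem : Ω' ∈ L.lattice := (hmem Ω').mpr ⟨0, 1, by push_cast; ring⟩
  have uniq : ∀ {a b a' b' : ℤ}, (a : ℂ) * Ω + (b : ℂ) * Ω' = (a' : ℂ) * Ω + (b' : ℂ) * Ω' → a = a' ∧ b = b' := by
    intro a b a' b' hab
    rw [hΩ, hΩ', ← hω₁, ← hω₂] at hab
    exact periodPair_coords_unique L₁ hab
  -- the three parity conditions in coordinates
  have hP : (∃ k : ℤ, ∃ w ∈ L.lattice, z = (k : ℂ) * Ω + 2 * w) ↔ Even n := by
    constructor
    · rintro ⟨k, w, hw, hzw⟩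
      obtain ⟨m', n', hw'⟩ := (hmem w).mp hw
      have e : (m : ℂ) * Ω + (n : ℂ) * Ω' = ((k + 2 * m' : ℤ) : ℂ) * Ω + ((2 * n' : ℤ) : ℂ) * Ω' := by
        rw [hmn, hzw, ← hw']; push_cast; ring
      exact ⟨n', by have := (uniq e).2; omega⟩
    · rintro ⟨n', hn'⟩
      refine ⟨m, (n' : ℂ) * Ω', ?_, ?_⟩
      · rw [← zsmul_eq_mul]; exact zsmul_mem hΩ'mem n'
      · rw [← hmn, hn']; push_cast; ring
  have hQ : (∃ k : ℤ, ∃ w ∈ L.lattice, z = (k : ℂ) * Ω' + 2 * w) ↔ Even m := by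
    constructor
    · rintro ⟨k, w, hw, hzw⟩
      obtain ⟨m', n', hw'⟩ := (hmem w).mp hw
      have e : (m : ℂ) * Ω + (n : ℂ) * Ω' = ((2 * m' : ℤ) : ℂ) * Ω + ((k + 2 * n' : ℤ) : ℂ) * Ω' := by
        rw [hmn, hzw, ← hw']; push_cast; ring
      exact ⟨m', by have := (uniq e).1; omega⟩
    · rintro ⟨m', hm'⟩
      refine ⟨n, (m' : ℂ) * Ω, ?_, ?_⟩
      · rw [← zsmul_eq_mul]; exact zsmul_mem hΩmem m'
      · rw [← hmn, hm']; push_cast; ring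
  have hR : (∃ k : ℤ, ∃ w ∈ L.lattice, z = (k : ℂ) * (Ω + Ω') + 2 * w) ↔ Even (m - n) := by
    constructor
    · rintro ⟨k, w, hw, hzw⟩
      obtain ⟨m', n', hw'⟩ := (hmem w).mp hw
      have e : (m : ℂ) * Ω + (n : ℂ) * Ω' = ((k + 2 * m' : ℤ) : ℂ) * Ω + ((k + 2 * n' : ℤ) : ℂ) * Ω' := by
        rw [hmn, hzw, ← hw']; push_cast; ring
      obtain ⟨e1, e2⟩ := uniq e
      exact ⟨m' - n', by omega⟩
    · rintro ⟨t, ht⟩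
      refine ⟨n, (t : ℂ) * Ω, ?_, ?_⟩
      · rw [← zsmul_eq_mul]; exact zsmul_mem hΩmem t
      · have hm : (m : ℂ) = n + (t + t : ℤ) := by rw [← ht]; push_cast; ring
        rw [← hmn, hm]; push_cast; ring
  rw [hR, hP, hQ, Int.even_sub]
  exact iff_comm

end ParityLattices

/-! ### §2. The two pure parities of `z = q·u`, `u ∈ Λ_f`: real period ↔ minus symbol, imaginary period ↔ plus symbol -/

section PureParities

variable {N : ℕ} [NeZero N] (f : CuspForm (Gamma0 N) 2) {L₀ : PeriodPair}

omit [NeZero N] in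
/-- **Real half period ↔ minus parity.**  For a real lattice `Λ₀ = q·Λ_f` (`q ∈ ℚ^×`), `im Λ_f = ℤ·Ω⁻/2` and `u ∈ Λ_f` with
`im u = n⁻·Ω⁻/2`: `q·u ∈ ℤΩ₀ + 2Λ₀ ⟺ n⁻` even (`Λ₀ ∩ ℝ = ℤΩ₀`, `IsReal.exists_eq_int_mul`). [cite: CremonaAlgorithms1997, §2.8]
[cite: Lawden1989, §6.15] -/
theorem star_loopParity_real (hreal : L₀.IsReal) {q : ℚ} (hq : q ≠ 0)
    (hsub : ∀ z ∈ periodLattice f, (q : ℂ) * z ∈ L₀.lattice) (hsup : ∀ z ∈ L₀.lattice, ∃ w ∈ periodLattice f, z = (q : ℂ) * w)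
    {Ωm : ℝ} (hΩm : imagPeriods f = AddSubgroup.zmultiples (Ωm / 2)) (hΩm0 : 0 < Ωm)
    {u : ℂ} (hu : u ∈ periodLattice f) {nm : ℤ} (hum : u.im = nm * (Ωm / 2)) :
    (∃ k : ℤ, ∃ w ∈ L₀.lattice, (q : ℂ) * u = (k : ℂ) * (L₀.minRealPeriod : ℂ) + 2 * w) ↔ Even nm := by
  -- every `z ∈ Λ_f` has `im z = j·Ωm/2`, and `Ωm/2` is attained
  have hint : ∀ z ∈ periodLattice f, ∃ j : ℤ, z.im = j * (Ωm / 2) := by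
    intro z hz
    have hz' : z.im ∈ imagPeriods f := AddSubgroup.mem_map_of_mem _ hz
    rw [hΩm, AddSubgroup.mem_zmultiples_iff] at hz'
    obtain ⟨j, hj⟩ := hz'
    exact ⟨j, by rw [← hj, zsmul_eq_mul]⟩
  have hgen : ∃ z₂ ∈ periodLattice f, z₂.im = Ωm / 2 := by
    have : Ωm / 2 ∈ imagPeriods f := by rw [hΩm]; exact AddSubgroup.mem_zmultiples _
    rw [imagPeriods, AddSubgroup.mem_map] at this
    obtain ⟨z₂, hz₂, hz₂im⟩ := this
    exact ⟨z₂, hz₂, hz₂im⟩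
  constructor
  · -- `q u = kΩ₀ + 2ν`, `ν = q z₃`: imaginary parts give `q·nm·Ωm/2 = q·j·Ωm`
    rintro ⟨k, ν, hν, hk⟩
    obtain ⟨z₃, hz₃, rfl⟩ := hsup ν hν
    obtain ⟨j, hj⟩ := hint z₃ hz₃
    have h1 := congr_arg Complex.im hk
    simp only [Complex.mul_im, Complex.ratCast_re, Complex.ratCast_im, zero_mul, add_zero, hum, Complex.add_im,
      Complex.intCast_re, Complex.intCast_im, Complex.ofReal_re, Complex.ofReal_im, mul_zero, Complex.re_ofNat,
      Complex.im_ofNat, hj, Complex.mul_re, sub_zero, zero_add] at h1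
    have h2 : (nm : ℝ) = 2 * j := by
      have hqΩ : (q : ℝ) * (Ωm / 2) ≠ 0 := mul_ne_zero (by exact_mod_cast hq) (by positivity)
      apply mul_right_cancel₀ hqΩ
      linarith
    exact ⟨j, by exact_mod_cast (show (nm : ℝ) = j + j by linarith)⟩
  · -- `nm = 2m`: `q u − 2 q m z₂` is a REAL lattice point, hence `kΩ₀`
    rintro ⟨m, rfl⟩
    obtain ⟨z₂, hz₂, hz₂im⟩ := hgen
    have hν : (q : ℂ) * ((m : ℂ) * z₂) ∈ L₀.lattice := by
      have : (m : ℂ) * z₂ ∈ periodLattice f := by rw [← zsmul_eq_mul]; exact zsmul_mem hz₂ m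
      exact hsub _ this
    set t : ℂ := (q : ℂ) * u - 2 * ((q : ℂ) * ((m : ℂ) * z₂)) with ht
    have htmem : t ∈ L₀.lattice := sub_mem (hsub _ hu) (by rw [two_mul]; exact add_mem hν hν)
    have htim : t.im = 0 := by
      simp only [ht, Complex.sub_im, Complex.mul_im, Complex.ratCast_re, Complex.ratCast_im, zero_mul, add_zero, hum,
        Complex.intCast_re, Complex.intCast_im, hz₂im, Complex.re_ofNat, Complex.im_ofNat, Complex.mul_re, sub_zero]
      push_cast
      ring
    have htre : t = ((t.re : ℝ) : ℂ) := Complex.ext (by simp) (by simp [htim])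
    obtain ⟨k, hk⟩ := hreal.exists_eq_int_mul (t := t.re) (by rw [← htre]; exact htmem)
    refine ⟨k, (q : ℂ) * ((m : ℂ) * z₂), hν, ?_⟩
    have : (q : ℂ) * u = t + 2 * ((q : ℂ) * ((m : ℂ) * z₂)) := by rw [ht]; ring
    rw [this, htre, hk]
    push_cast
    ring

omit [NeZero N] in
/-- **Imaginary period ↔ plus parity** (the core of `star_plusOddClass`, isolated).  For a real lattice `Λ₀ = q·Λ_f`,
`re Λ_f = ℤ·Ω⁺/2` and `u ∈ Λ_f` with `re u = n⁺·Ω⁺/2`: `q·u ∈ ℤ·iΩ₀' + 2Λ₀ ⟺ n⁺` even (purely imaginary lattice points are the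
multiples of `iΩ₀'`, `exists_eq_int_mul_I_of_re_eq_zero`). [cite: CremonaAlgorithms1997, §2.8] [cite: Lawden1989, §6.15] -/
theorem star_loopParity_imag (hreal : L₀.IsReal) {q : ℚ} (hq : q ≠ 0)
    (hsub : ∀ z ∈ periodLattice f, (q : ℂ) * z ∈ L₀.lattice) (hsup : ∀ z ∈ L₀.lattice, ∃ w ∈ periodLattice f, z = (q : ℂ) * w)
    {Ωp : ℝ} (hΩp : realPeriods f = AddSubgroup.zmultiples (Ωp / 2)) (hΩp0 : 0 < Ωp)
    {u : ℂ} (hu : u ∈ periodLattice f) {np : ℤ} (hure : u.re = np * (Ωp / 2)) :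
    (∃ k : ℤ, ∃ w ∈ L₀.lattice, (q : ℂ) * u = (k : ℂ) * (I * (L₀.mulLeft I I_ne_zero).minRealPeriod) + 2 * w) ↔ Even np := by
  set w : ℂ := I * ((((L₀.mulLeft I I_ne_zero).minRealPeriod / 2 : ℝ)) : ℂ) with hw
  have h2w : I * ((L₀.mulLeft I I_ne_zero).minRealPeriod : ℂ) = 2 * w := by rw [hw]; push_cast; ring
  have hint : ∀ z ∈ periodLattice f, ∃ j : ℤ, z.re = j * (Ωp / 2) := by
    intro z hz
    have hz' : z.re ∈ realPeriods f := AddSubgroup.mem_map_of_mem _ hz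
    rw [hΩp, AddSubgroup.mem_zmultiples_iff] at hz'
    obtain ⟨j, hj⟩ := hz'
    exact ⟨j, by rw [← hj, zsmul_eq_mul]⟩
  have hgen : ∃ z₁ ∈ periodLattice f, z₁.re = Ωp / 2 := by
    have : Ωp / 2 ∈ realPeriods f := by rw [hΩp]; exact AddSubgroup.mem_zmultiples _
    rw [realPeriods, AddSubgroup.mem_map] at this
    obtain ⟨z₁, hz₁, hz₁re⟩ := this
    exact ⟨z₁, hz₁, hz₁re⟩
  have hwre : w.re = 0 := by
    rw [hw, Complex.mul_re, Complex.I_re, Complex.I_im, Complex.ofReal_re, Complex.ofReal_im]; ring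
  constructor
  · rintro ⟨k, ν, hν, hk⟩
    obtain ⟨z, hz, rfl⟩ := hsup ν hν
    obtain ⟨j, hj⟩ := hint z hz
    rw [h2w] at hk
    have h1 := congr_arg Complex.re hk
    simp only [Complex.mul_re, Complex.ratCast_re, Complex.ratCast_im, zero_mul, sub_zero, hure,
      Complex.add_re, Complex.intCast_re, Complex.intCast_im, Complex.re_ofNat, Complex.im_ofNat, hj, hwre,
      mul_zero] at h1
    have h2 : (np : ℝ) = 2 * j := by
      have hqΩ : (q : ℝ) * (Ωp / 2) ≠ 0 := mul_ne_zero (by exact_mod_cast hq) (by positivity)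
      apply mul_right_cancel₀ hqΩ
      linarith
    exact ⟨j, by exact_mod_cast (show (np : ℝ) = j + j by linarith)⟩
  · rintro ⟨m, rfl⟩
    obtain ⟨z₁, hz₁, hz₁re⟩ := hgen
    have hν : (q : ℂ) * ((m : ℂ) * z₁) ∈ L₀.lattice := by
      have : (m : ℂ) * z₁ ∈ periodLattice f := by rw [← zsmul_eq_mul]; exact zsmul_mem hz₁ m
      exact hsub _ this
    have hdiff : (q : ℂ) * u - 2 * ((q : ℂ) * ((m : ℂ) * z₁)) ∈ L₀.lattice :=
      sub_mem (hsub _ hu) (by rw [two_mul]; exact add_mem hν hν)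
    have hre0 : ((q : ℂ) * u - 2 * ((q : ℂ) * ((m : ℂ) * z₁))).re = 0 := by
      simp only [Complex.sub_re, Complex.mul_re, Complex.ratCast_re, Complex.ratCast_im, zero_mul, sub_zero,
        Complex.intCast_re, Complex.intCast_im, hure, hz₁re, Complex.re_ofNat, Complex.im_ofNat]
      push_cast
      ring
    obtain ⟨k, hk⟩ := exists_eq_int_mul_I_of_re_eq_zero hreal hdiff hre0
    refine ⟨k, (q : ℂ) * ((m : ℂ) * z₁), hν, ?_⟩
    rw [h2w, ← hk]
    ring

end PureParities

/-! ### §3. Minus-symbol bookkeeping on the cusps `b/d`, `gcd(d, bN_W) = 1` -/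

section Symbols

variable {N : ℕ} [NeZero N]

/-- For a newform `f` of `W` and a cusp `b/d` with `d > 0`, `gcd(d, b·N_W) = 1`: `u = {∞,b/d}_f − {∞,0}_f ∈ Λ_f`, and
`[b/d]⁺ − [0]⁺ = n⁺/2`, `[b/d]⁻ − [0]⁻ = n⁻/2` with `re u = n⁺Ω⁺/2`, `im u = n⁻Ω⁻/2` (`re Λ_f = ℤΩ⁺/2`, `im Λ_f = ℤΩ⁻/2`, Manin;
`{∞,0}` is real for real `f`). [cite: MazurTateTeitelbaum1986Invent, §I.8] [cite: CremonaAlgorithms1997, §2.8] -/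
theorem exists_plus_minus_symbol_data (W : WeierstrassCurve ℚ) [W.IsElliptic] (f : CuspForm (Gamma0 N) 2)
    (hfW : IsNewformOf W f) {b d : ℤ} (hcop : Int.gcd d (b * (W.conductorNorm ℤ : ℕ)) = 1) :
    0 < plusPeriod f ∧ realPeriods f = AddSubgroup.zmultiples (plusPeriod f / 2) ∧
    0 < minusPeriod f ∧ imagPeriods f = AddSubgroup.zmultiples (minusPeriod f / 2) ∧
    modularSymbol f ((b : ℚ) / (d : ℚ)) - modularSymbol f 0 ∈ periodLattice f ∧
    ∃ np nm : ℤ, ratPlusSymbol f ((b : ℚ) / (d : ℚ)) - ratPlusSymbol f 0 = np * (1 / 2 : ℚ) ∧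
      ratMinusSymbol f ((b : ℚ) / (d : ℚ)) - ratMinusSymbol f 0 = nm * (1 / 2 : ℚ) ∧
      (modularSymbol f ((b : ℚ) / (d : ℚ)) - modularSymbol f 0).re = np * (plusPeriod f / 2) ∧
      (modularSymbol f ((b : ℚ) / (d : ℚ)) - modularSymbol f 0).im = nm * (minusPeriod f / 2) := by
  set M : ℕ := W.conductorNorm ℤ with hM
  have hQ := hfW.coeffField_eq_bot
  have hreal_f : ∀ n, (cuspCoeff f n).im = 0 := cuspCoeff_im_eq_zero_of_coeffField_eq_bot hQ
  obtain ⟨hpos, hre⟩ := plusPeriod_pos_and_realPeriods_eq (isZLattice_periodLattice_holds (f := f)) hfW.1 hQ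
  -- the minus period
  obtain ⟨hΩm_ne, -⟩ := IsNewform0.exists_rat_smul_minusPeriod_holds (f := f) hfW.1 hQ
  have hmpos : 0 < minusPeriod f ∧ imagPeriods f = AddSubgroup.zmultiples (minusPeriod f / 2) :=
    (minusPeriod_eq_zero_or f).resolve_left hΩm_ne
  set Ω := plusPeriod f with hΩ
  set Ωm := minusPeriod f with hΩmdef
  -- the cusp `b/d` has denominator prime to the level
  have hprime : ∀ p : ℕ, p.Prime → (p ∣ N ↔ p ∣ M) := fun p hp ↦ hfW.dvd_level_iff_dvd_conductorNorm hp
  have hx' : Nat.Coprime (((b : ℚ) / (d : ℚ))).den N := by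
    apply Nat.Coprime.symm
    apply Nat.coprime_of_dvd
    intro p hp hpN hpden
    have hpM : p ∣ M := (hprime p hp).mp hpN
    have hden : ((((b : ℚ) / (d : ℚ))).den : ℤ) ∣ d := by
      rw [← Rat.divInt_eq_div]; exact Rat.den_dvd b d
    have hpd : (p : ℤ) ∣ d := (Int.natCast_dvd_natCast.mpr hpden).trans hden
    have hpbM : (p : ℤ) ∣ b * (M : ℕ) := Dvd.dvd.mul_left (Int.natCast_dvd_natCast.mpr hpM) b
    have h1 : (p : ℤ) ∣ (Int.gcd d (b * (M : ℕ)) : ℤ) := Int.dvd_coe_gcd hpd hpbM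
    rw [hcop] at h1
    exact hp.one_lt.ne' (by exact_mod_cast Int.eq_one_of_dvd_one (by positivity) h1)
  have hmem : modularSymbol f ((b : ℚ) / (d : ℚ)) - modularSymbol f 0 ∈ periodLattice f :=
    modularSymbol_sub_zero_mem_periodLattice f hx'
  -- `{∞,0}` is real
  have h0im : (modularSymbol f 0).im = 0 := by
    have h := minusSymbol_eq_im_mul_I_holds f hreal_f 0
    rw [minusSymbol_zero] at h
    have h' : ((modularSymbol f 0).im : ℂ) = 0 := by
      have := mul_eq_zero.mp h.symm
      exact this.resolve_right I_ne_zero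
    exact_mod_cast h'
  obtain ⟨np, hnp⟩ := exists_re_eq_add_of_sub_mem f hre hmem
  obtain ⟨nm, hnm⟩ := exists_im_eq_of_sub_mem f hmpos.2 hmem h0im
  refine ⟨hpos, hre, hmpos.1, hmpos.2, hmem, np, nm, ?_, ?_, ?_, ?_⟩
  · -- `[b/d]⁺ − [0]⁺ = n⁺/2`
    have hΩ0 : Ω ≠ 0 := hpos.ne'
    apply Rat.cast_injective (α := ℝ)
    push_cast
    rw [ratCast_ratPlusSymbol_holds hfW.1 hQ ((b : ℚ) / (d : ℚ)), ratCast_ratPlusSymbol_holds hfW.1 hQ 0,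
      normalizedPlusSymbol, normalizedPlusSymbol, plusSymbol_eq_re_holds f hreal_f, plusSymbol_eq_re_holds f hreal_f,
      Complex.ofReal_re, Complex.ofReal_re, hnp, ← hΩ]
    field_simp
    ring
  · -- `[b/d]⁻ − [0]⁻ = n⁻/2`
    have hΩ0 : Ωm ≠ 0 := hmpos.1.ne'
    apply Rat.cast_injective (α := ℝ)
    push_cast
    have him : (minusSymbol f ((b : ℚ) / (d : ℚ))).im = (modularSymbol f ((b : ℚ) / (d : ℚ))).im := by
      rw [minusSymbol_eq_im_mul_I_holds f hreal_f, Complex.mul_im, Complex.ofReal_re, Complex.ofReal_im, Complex.I_re,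
        Complex.I_im]
      ring
    rw [ratCast_ratMinusSymbol f hfW.1 hQ ((b : ℚ) / (d : ℚ)), ratMinusSymbol_zero, normalizedMinusSymbol, him, hnm, ← hΩmdef]
    push_cast
    field_simp
    ring
  · rw [Complex.sub_re, hnp]; ring
  · rw [Complex.sub_im, h0im, hnm]; ring

end Symbols

end Summit.BirchSwinnertonDyer.BirchSwinnertonDyer.Theorems.DepletionAtTwo

end
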